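import Mathlib.Analysis.Calculus.InverseFunctionTheorem.ContDiff
import Literature.Topology.FourManifolds.NormalFrameTransport
import Literature.Topology.FourManifolds.AffineTubeLocal
import Literature.Topology.FourManifolds.FramedTubularNbhd
import Summits.SmoothPoincare4.SmoothPoincare4.Theses.DottedCircleRasmussen

/-!
# Helper `helper_friendsCarrier_Vk_discTube` (piece 4 of the registered helper `helper_friendsCarrier_Vk`,
stub `stub_friendsCarrier`, line `mk_friends`, skeleton v5) for crux `DcrGap`
(item stmt-SmoothPoincare4-16128, route route-SmoothPoincare4-DottedCircleRasmussen)

**A framed tube, with smooth inverse, of a slightly enlarged embedded disc in `ℝ⁴`.**  The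
straightening of the model slice disc `f₁ : ℝ² → ℝ⁴` in the exterior collar of `M_k = ∂D_k` (debt V_k
of the carrier stub) is done by adapting the collar flow to the disc: the clock field of
`helper_friendsCarrier_Vk_clockFlow` is blended, near the boundary circle `K₁ = f₁(S¹)`, with a field
tangent to the disc.  That needs coordinates around the disc ON BOTH SIDES of the boundary circle, i.e.
a tube of `f₁` restricted to a disc of radius `> 1`.  This file provides it from the disc clauses of
`MMSW.IsModelSliceDisc` alone (`C^∞`, injective and immersive on the closed unit disc):

* `FriendsCarrierVk.exists_injOn_closedBall_of_immersion` — an immersion injective on the closed unit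
  disc is injective (and immersive) on a larger closed disc (local injectivity at immersive points from
  the mean value inequality, `AffineTube.injOn_of_hasFDerivWithinAt_of_antilipschitz`, spread over the
  compact diagonal: Hirsch, Ch. 2 §1 Ex. 7);
* `FriendsCarrierVk.exists_discTube` — with a `C^∞` normal frame `n₀, n₁` of the enlarged disc (tree:
  `exists_normalFrame`, `NormalFrameTransport.lean`), the tube `F(x, w) = f₁ x + w₀ n₀ x + w₁ n₁ x` is
  injective on `B̄(0, 1 + δ) × B̄(0, η)` (tree: `exists_injOn_prod_ball`), open on `B(0, 1 + δ) × B(0, η)`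
  with a `C^∞` inverse there (inverse function theorem), and `F(x, 0) = f₁ x`;
* `helper_friendsCarrier_Vk_discTube` — the registered statement for a model slice disc.

No definitions (the tube is an explicit lambda), no named facts, no `sorry`.

## References

* M. W. Hirsch, *Differential Topology*, GTM 33 (1976), Ch. 4 §5 Thm. 5.1 (tubular neighbourhoods),
  Ch. 2 §1 Ex. 7 (an immersion injective on a compact set is injective near it). [Hirsch1976]
-/

-- the prescribed namespace `Summit.<P>.<Sub>.…` duplicates `SmoothPoincare4` (P = Sub)
set_option linter.dupNamespace false
set_option linter.style.longLine false

noncomputable section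

open scoped Manifold ContDiff Topology
open Set Function Metric Filter
open Literature.Topology.FourManifolds Literature.Topology.FourManifolds.MMSW

namespace Summit.SmoothPoincare4.SmoothPoincare4.Theorems.DcrGap.MkFriends

namespace FriendsCarrierVk

/-! ## Injective immersions of the closed disc stay injective a little further -/

/-- An injective linear map from `ℝ²` is bounded below. [folklore] -/
theorem exists_bound_of_injective_clm (L : EuclideanSpace ℝ (Fin 2) →L[ℝ] EuclideanSpace ℝ (Fin 4))
    (hL : Injective L) : ∃ c > 0, ∀ v, c * ‖v‖ ≤ ‖L v‖ := by
  let L' : EuclideanSpace ℝ (Fin 2) →ₗ[ℝ] EuclideanSpace ℝ (Fin 4) := L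
  have hL' : Injective L' := hL
  let e₀ : EuclideanSpace ℝ (Fin 2) ≃ₗ[ℝ] LinearMap.range L' := LinearEquiv.ofInjective L' hL'
  let e : EuclideanSpace ℝ (Fin 2) ≃L[ℝ] LinearMap.range L' := e₀.toContinuousLinearEquiv
  refine ⟨(‖(e.symm : LinearMap.range L' →L[ℝ] EuclideanSpace ℝ (Fin 2))‖ + 1)⁻¹, by positivity, fun v => ?_⟩
  have h1 : ‖v‖ ≤ ‖(e.symm : LinearMap.range L' →L[ℝ] EuclideanSpace ℝ (Fin 2))‖ * ‖e v‖ := by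
    have := (e.symm : LinearMap.range L' →L[ℝ] EuclideanSpace ℝ (Fin 2)).le_opNorm (e v)
    rwa [show (e.symm : LinearMap.range L' →L[ℝ] EuclideanSpace ℝ (Fin 2)) (e v) = v from e.symm_apply_apply v] at this
  have h2 : ‖e v‖ = ‖L v‖ := rfl
  rw [h2] at h1
  rw [inv_mul_le_iff₀ (by positivity)]
  nlinarith [norm_nonneg (L v), norm_nonneg v]

/-- A `C^∞` map is injective near each immersive point. [cite: Hirsch1976, Ch. 2 §1 Ex. 7] -/
theorem exists_injOn_ball_of_injective_fderiv {f : EuclideanSpace ℝ (Fin 2) → EuclideanSpace ℝ (Fin 4)}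
    (hf : ContDiff ℝ ∞ f) {x : EuclideanSpace ℝ (Fin 2)} (hx : Injective (fderiv ℝ f x)) :
    ∃ r > 0, InjOn f (ball x r) := by
  obtain ⟨c, hc, hbelow⟩ := exists_bound_of_injective_clm _ hx
  have hd : ∀ p ∈ (univ : Set (EuclideanSpace ℝ (Fin 2))), HasFDerivWithinAt f (fderiv ℝ f p) univ p :=
    fun p _ => ((hf.differentiable (by simp)) p).hasFDerivAt.hasFDerivWithinAt
  have hcont : ContinuousWithinAt (fderiv ℝ f) univ x :=
    (hf.continuous_fderiv (by simp)).continuousWithinAt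
  obtain ⟨r, hr, hinj⟩ := AffineTube.injOn_of_hasFDerivWithinAt_of_antilipschitz convex_univ hd hcont hc hbelow
  exact ⟨r, hr, by simpa using hinj⟩

/-- **An immersion injective on the closed unit disc is an injective immersion on a larger closed
disc.** [cite: Hirsch1976, Ch. 2 §1 Ex. 7] -/
theorem exists_injOn_closedBall_of_immersion {f : EuclideanSpace ℝ (Fin 2) → EuclideanSpace ℝ (Fin 4)}
    (hf : ContDiff ℝ ∞ f) (hinj : InjOn f (closedBall 0 1))
    (himm : ∀ x ∈ closedBall (0 : EuclideanSpace ℝ (Fin 2)) 1, Injective (fderiv ℝ f x)) :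
    ∃ δ > 0, InjOn f (closedBall 0 (1 + δ)) ∧
      ∀ x ∈ closedBall (0 : EuclideanSpace ℝ (Fin 2)) (1 + δ), Injective (fderiv ℝ f x) := by
  obtain ⟨R₁, hR₁, himm₁⟩ := exists_ball_injective_fderiv hf one_pos himm
  -- the separation property near the compact diagonal block
  set X : Set (EuclideanSpace ℝ (Fin 2)) := closedBall 0 1 with hX
  have hXc : IsCompact X := isCompact_closedBall _ _
  set S : Set (EuclideanSpace ℝ (Fin 2) × EuclideanSpace ℝ (Fin 2)) := {p | f p.1 = f p.2 → p.1 = p.2} with hS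
  have hnhds : ∀ p ∈ X ×ˢ X, S ∈ 𝓝 p := by
    rintro ⟨x, y⟩ ⟨hx, hy⟩
    by_cases hxy : f x = f y
    · obtain rfl : x = y := hinj hx hy hxy
      obtain ⟨r, hr, hloc⟩ := exists_injOn_ball_of_injective_fderiv hf (himm x hx)
      have h1 : ∀ᶠ p : EuclideanSpace ℝ (Fin 2) × EuclideanSpace ℝ (Fin 2) in 𝓝 (x, x), p.1 ∈ ball x r :=
        continuous_fst.continuousAt.preimage_mem_nhds (ball_mem_nhds x hr)
      have h2 : ∀ᶠ p : EuclideanSpace ℝ (Fin 2) × EuclideanSpace ℝ (Fin 2) in 𝓝 (x, x), p.2 ∈ ball x r :=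
        continuous_snd.continuousAt.preimage_mem_nhds (ball_mem_nhds x hr)
      filter_upwards [h1, h2] with p hp1 hp2 hp
      exact hloc hp1 hp2 hp
    · have hopen : IsOpen {p : EuclideanSpace ℝ (Fin 4) × EuclideanSpace ℝ (Fin 4) | p.1 ≠ p.2} :=
        isClosed_diagonal.isOpen_compl
      have hc : Continuous fun p : EuclideanSpace ℝ (Fin 2) × EuclideanSpace ℝ (Fin 2) => (f p.1, f p.2) :=
        (hf.continuous.comp continuous_fst).prodMk (hf.continuous.comp continuous_snd)
      have h3 : ∀ᶠ p : EuclideanSpace ℝ (Fin 2) × EuclideanSpace ℝ (Fin 2) in 𝓝 (x, y), f p.1 ≠ f p.2 :=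
        hc.continuousAt.preimage_mem_nhds (hopen.mem_nhds (by simpa using hxy))
      filter_upwards [h3] with p hp hp'
      exact absurd hp' hp
  have hSn : S ∈ 𝓝ˢ (X ×ˢ X) := by
    rw [mem_nhdsSet_iff_forall]; exact hnhds
  rw [hXc.nhdsSet_prod_eq hXc, Filter.mem_prod_iff] at hSn
  obtain ⟨U, hU, V, hV, hUV⟩ := hSn
  obtain ⟨U', hU'o, hXU', hU'U⟩ := mem_nhdsSet_iff_exists.1 hU
  obtain ⟨V', hV'o, hXV', hV'V⟩ := mem_nhdsSet_iff_exists.1 hV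
  obtain ⟨ε₁, hε₁, hthU⟩ := hXc.exists_thickening_subset_open hU'o hXU'
  obtain ⟨ε₂, hε₂, hthV⟩ := hXc.exists_thickening_subset_open hV'o hXV'
  -- the radius
  set δ : ℝ := min (min ε₁ ε₂) (R₁ - 1) / 2 with hδ
  have hδpos : 0 < δ := by
    rw [hδ]; have := lt_min (lt_min hε₁ hε₂) (sub_pos.2 hR₁); linarith
  have hδ1 : 1 + δ < 1 + ε₁ := by
    have : min (min ε₁ ε₂) (R₁ - 1) ≤ ε₁ := (min_le_left _ _).trans (min_le_left _ _)
    rw [hδ]; linarith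
  have hδ2 : 1 + δ < 1 + ε₂ := by
    have : min (min ε₁ ε₂) (R₁ - 1) ≤ ε₂ := (min_le_left _ _).trans (min_le_right _ _)
    rw [hδ]; linarith
  have hδR : 1 + δ < R₁ := by
    have : min (min ε₁ ε₂) (R₁ - 1) ≤ R₁ - 1 := min_le_right _ _
    rw [hδ]; linarith
  have hmemU : ∀ x ∈ closedBall (0 : EuclideanSpace ℝ (Fin 2)) (1 + δ), x ∈ U := fun x hx => by
    refine hU'U (hthU ?_)
    rw [hX, thickening_closedBall hε₁ zero_le_one, add_comm]
    exact mem_ball_zero_iff.2 (lt_of_le_of_lt (mem_closedBall_zero_iff.1 hx) hδ1)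
  have hmemV : ∀ x ∈ closedBall (0 : EuclideanSpace ℝ (Fin 2)) (1 + δ), x ∈ V := fun x hx => by
    refine hV'V (hthV ?_)
    rw [hX, thickening_closedBall hε₂ zero_le_one, add_comm]
    exact mem_ball_zero_iff.2 (lt_of_le_of_lt (mem_closedBall_zero_iff.1 hx) hδ2)
  refine ⟨δ, hδpos, fun x hx y hy hxy => ?_, fun x hx => himm₁ x ?_⟩
  · exact hUV (mk_mem_prod (hmemU x hx) (hmemV y hy)) hxy
  · exact mem_ball_zero_iff.2 (lt_of_le_of_lt (mem_closedBall_zero_iff.1 hx) hδR)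

/-! ## The framed tube of the enlarged disc -/

/-- **The framed tube of an enlarged embedded disc, with smooth inverse.**  For `f : ℝ² → ℝ⁴` of class
`C^∞`, injective and immersive on the closed unit disc, there are `δ, η > 0` and maps
`F : ℝ² × ℝ² → ℝ⁴`, `Finv : ℝ⁴ → ℝ² × ℝ²` with: `F(x, w) = f x + w₀ n₀ x + w₁ n₁ x` for `C^∞` fields
`n₀, n₁` on `B(0, 1 + 2δ)` (so `F(x, 0) = f x` and `F` is `C^∞` on `B(0, 1 + 2δ) × ℝ²`), `f` injective
on `B̄(0, 1 + δ)`, `F` injective on `B̄(0, 1 + δ) × B̄(0, η)`, the image `F(B(0, 1 + δ) × B(0, η))` open,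
and `Finv` a `C^∞` left inverse of `F` on it. [cite: Hirsch1976, Ch. 4 §5 Thm. 5.1] -/
theorem exists_discTube {f : EuclideanSpace ℝ (Fin 2) → EuclideanSpace ℝ (Fin 4)}
    (hf : ContDiff ℝ ∞ f) (hinj : InjOn f (closedBall 0 1))
    (himm : ∀ x ∈ closedBall (0 : EuclideanSpace ℝ (Fin 2)) 1, Injective (fderiv ℝ f x)) :
    ∃ (δ η : ℝ) (F : EuclideanSpace ℝ (Fin 2) × EuclideanSpace ℝ (Fin 2) → EuclideanSpace ℝ (Fin 4))
      (Finv : EuclideanSpace ℝ (Fin 4) → EuclideanSpace ℝ (Fin 2) × EuclideanSpace ℝ (Fin 2)),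
      0 < δ ∧ 0 < η ∧ InjOn f (closedBall 0 (1 + δ)) ∧
      (∀ x ∈ ball (0 : EuclideanSpace ℝ (Fin 2)) (1 + 2 * δ), Injective (fderiv ℝ f x)) ∧
      (∀ x, F (x, 0) = f x) ∧
      ContDiffOn ℝ ∞ F (ball (0 : EuclideanSpace ℝ (Fin 2)) (1 + 2 * δ) ×ˢ univ) ∧
      InjOn F (closedBall (0 : EuclideanSpace ℝ (Fin 2)) (1 + δ) ×ˢ closedBall (0 : EuclideanSpace ℝ (Fin 2)) η) ∧
      IsOpen (F '' (ball (0 : EuclideanSpace ℝ (Fin 2)) (1 + δ) ×ˢ ball (0 : EuclideanSpace ℝ (Fin 2)) η)) ∧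
      ContDiffOn ℝ ∞ Finv (F '' (ball (0 : EuclideanSpace ℝ (Fin 2)) (1 + δ) ×ˢ ball (0 : EuclideanSpace ℝ (Fin 2)) η)) ∧
      (∀ q ∈ ball (0 : EuclideanSpace ℝ (Fin 2)) (1 + δ) ×ˢ ball (0 : EuclideanSpace ℝ (Fin 2)) η, Finv (F q) = q) := by
  -- injectivity and immersivity on a larger closed disc, then a normal frame beyond it
  obtain ⟨δ₀, hδ₀, hinj₀, himm₀⟩ := exists_injOn_closedBall_of_immersion hf hinj himm
  obtain ⟨R', n, hR', himm', hns, hnP, hnli⟩ :=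
    exists_normalFrame hf (finrank_euclideanSpace_fin (𝕜 := ℝ) (n := 4)) (by linarith : (0 : ℝ) < 1 + δ₀) himm₀
  -- radii: `1 + 2δ < R'`, `δ ≤ δ₀`
  set δ : ℝ := min δ₀ ((R' - (1 + δ₀)) / 2) / 2 with hδdef
  have hδpos : 0 < δ := by
    rw [hδdef]; have := lt_min hδ₀ (by linarith : (0 : ℝ) < (R' - (1 + δ₀)) / 2); linarith
  have hδδ₀ : δ ≤ δ₀ := by
    rw [hδdef]; have := min_le_left δ₀ ((R' - (1 + δ₀)) / 2); linarith [hδ₀]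
  have h2δ : 1 + 2 * δ < R' := by
    rw [hδdef]; have := min_le_right δ₀ ((R' - (1 + δ₀)) / 2); linarith
  -- the tube
  set F : EuclideanSpace ℝ (Fin 2) × EuclideanSpace ℝ (Fin 2) → EuclideanSpace ℝ (Fin 4) :=
    fun q => f q.1 + q.2 0 • n 0 q.1 + q.2 1 • n 1 q.1 with hFdef
  have hF0 : ∀ x, F (x, 0) = f x := fun x => by simp [hFdef]
  -- smoothness on `B(0, R') × ℝ²`
  have hcoord : ∀ i : Fin 2, ContDiff ℝ ∞ fun q : EuclideanSpace ℝ (Fin 2) × EuclideanSpace ℝ (Fin 2) => q.2 i :=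
    fun i => by fun_prop
  have hFat : ∀ q : EuclideanSpace ℝ (Fin 2) × EuclideanSpace ℝ (Fin 2), q.1 ∈ ball (0 : EuclideanSpace ℝ (Fin 2)) R' →
      ContDiffAt ℝ ∞ F q := by
    intro q hq
    have hn' : ∀ i, ContDiffAt ℝ ∞ (fun q : EuclideanSpace ℝ (Fin 2) × EuclideanSpace ℝ (Fin 2) => n i q.1) q :=
      fun i => ((hns i).contDiffAt (isOpen_ball.mem_nhds hq)).comp q contDiffAt_fst
    simp only [hFdef]
    exact ((hf.contDiffAt.comp q contDiffAt_fst).add ((hcoord 0).contDiffAt.smul (hn' 0))).add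
      ((hcoord 1).contDiffAt.smul (hn' 1))
  have hFon : ContDiffOn ℝ ∞ F (ball (0 : EuclideanSpace ℝ (Fin 2)) (1 + 2 * δ) ×ˢ univ) := fun q hq =>
    (hFat q (ball_subset_ball h2δ.le hq.1)).contDiffWithinAt
  -- the derivative along the zero section: `(v, a) ↦ df v + a₀ n₀ + a₁ n₁`, injective by transversality
  set L₀ : EuclideanSpace ℝ (Fin 2) → (EuclideanSpace ℝ (Fin 2) × EuclideanSpace ℝ (Fin 2) →L[ℝ] EuclideanSpace ℝ (Fin 4)) :=
    fun x => (fderiv ℝ f x).comp (ContinuousLinearMap.fst ℝ (EuclideanSpace ℝ (Fin 2)) (EuclideanSpace ℝ (Fin 2))) +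
      ((EuclideanSpace.proj (𝕜 := ℝ) (0 : Fin 2)).comp
        (ContinuousLinearMap.snd ℝ (EuclideanSpace ℝ (Fin 2)) (EuclideanSpace ℝ (Fin 2)))).smulRight (n 0 x) +
      ((EuclideanSpace.proj (𝕜 := ℝ) (1 : Fin 2)).comp
        (ContinuousLinearMap.snd ℝ (EuclideanSpace ℝ (Fin 2)) (EuclideanSpace ℝ (Fin 2)))).smulRight (n 1 x) with hL₀def
  have hL₀apply : ∀ (x v a : EuclideanSpace ℝ (Fin 2)), L₀ x (v, a) = fderiv ℝ f x v + a 0 • n 0 x + a 1 • n 1 x := by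
    intro x v a
    simp [hL₀def]
  have hderiv0 : ∀ x ∈ ball (0 : EuclideanSpace ℝ (Fin 2)) R', HasFDerivAt F (L₀ x) (x, 0) := by
    intro x hx
    have hf' : HasFDerivAt (fun q : EuclideanSpace ℝ (Fin 2) × EuclideanSpace ℝ (Fin 2) => f q.1)
        ((fderiv ℝ f x).comp (ContinuousLinearMap.fst ℝ (EuclideanSpace ℝ (Fin 2)) (EuclideanSpace ℝ (Fin 2)))) (x, 0) :=
      ((hf.differentiable (by simp)) x).hasFDerivAt.comp (x, 0) hasFDerivAt_fst
    have hni : ∀ i : Fin 2, HasFDerivAt (fun q : EuclideanSpace ℝ (Fin 2) × EuclideanSpace ℝ (Fin 2) => q.2 i • n i q.1)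
        (((EuclideanSpace.proj (𝕜 := ℝ) i).comp
          (ContinuousLinearMap.snd ℝ (EuclideanSpace ℝ (Fin 2)) (EuclideanSpace ℝ (Fin 2)))).smulRight (n i x)) (x, 0) := by
      intro i
      have hc : HasFDerivAt (fun q : EuclideanSpace ℝ (Fin 2) × EuclideanSpace ℝ (Fin 2) => q.2 i)
          ((EuclideanSpace.proj (𝕜 := ℝ) i).comp
            (ContinuousLinearMap.snd ℝ (EuclideanSpace ℝ (Fin 2)) (EuclideanSpace ℝ (Fin 2)))) (x, 0) :=
        ((EuclideanSpace.proj (𝕜 := ℝ) i).hasFDerivAt).comp (x, 0) hasFDerivAt_snd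
      have hnd : HasFDerivAt (fun q : EuclideanSpace ℝ (Fin 2) × EuclideanSpace ℝ (Fin 2) => n i q.1)
          ((fderiv ℝ (n i) x).comp (ContinuousLinearMap.fst ℝ (EuclideanSpace ℝ (Fin 2)) (EuclideanSpace ℝ (Fin 2)))) (x, 0) :=
        ((((hns i).contDiffAt (isOpen_ball.mem_nhds hx)).differentiableAt (by simp)).hasFDerivAt).comp (x, 0)
          hasFDerivAt_fst
      refine (hc.fun_smul hnd).congr_fderiv ?_
      simp
    have h := (hf'.fun_add (hni 0)).fun_add (hni 1)
    rw [hFdef]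
    exact h
  have hinjL : ∀ x ∈ ball (0 : EuclideanSpace ℝ (Fin 2)) R', Injective (L₀ x) := by
    intro x hx
    have htr := (transversal_iff_linearIndependent_normProj (himm' x hx) (fun i => n i x)).2 (by
      have heq : (fun i => normProj (fderiv ℝ f x) (n i x)) = fun i => n i x := funext fun i => hnP x hx i
      rw [heq]; exact hnli x hx)
    refine (injective_iff_map_eq_zero _).2 ?_
    rintro ⟨v, a⟩ h
    have h' : fderiv ℝ f x v + ∑ i, a i • n i x = 0 := by
      rw [Fin.sum_univ_two, ← add_assoc, ← hL₀apply]
      exact h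
    obtain ⟨hv, ha⟩ := htr v a h'
    simp [hv, ha]
  -- the derivative as an equivalence along the zero section, strictness, local injectivity, openness
  have hfin : Module.finrank ℝ (EuclideanSpace ℝ (Fin 2) × EuclideanSpace ℝ (Fin 2)) = Module.finrank ℝ (EuclideanSpace ℝ (Fin 4)) := by
    simp
  have hstrict0 : ∀ x ∈ ball (0 : EuclideanSpace ℝ (Fin 2)) R', ∃ L : (EuclideanSpace ℝ (Fin 2) × EuclideanSpace ℝ (Fin 2)) ≃L[ℝ] EuclideanSpace ℝ (Fin 4),
      HasStrictFDerivAt F (L : _ →L[ℝ] _) (x, 0) := by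
    intro x hx
    have hbij : Bijective (L₀ x) := ⟨hinjL x hx,
      (LinearMap.injective_iff_surjective_of_finrank_eq_finrank hfin).1 (hinjL x hx)⟩
    set L : (EuclideanSpace ℝ (Fin 2) × EuclideanSpace ℝ (Fin 2)) ≃L[ℝ] EuclideanSpace ℝ (Fin 4) :=
      (LinearEquiv.ofBijective ((L₀ x : EuclideanSpace ℝ (Fin 2) × EuclideanSpace ℝ (Fin 2) →L[ℝ] EuclideanSpace ℝ (Fin 4)) :
        EuclideanSpace ℝ (Fin 2) × EuclideanSpace ℝ (Fin 2) →ₗ[ℝ] EuclideanSpace ℝ (Fin 4)) hbij).toContinuousLinearEquiv with hL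
    have hLc : (L : EuclideanSpace ℝ (Fin 2) × EuclideanSpace ℝ (Fin 2) →L[ℝ] EuclideanSpace ℝ (Fin 4)) = L₀ x :=
      ContinuousLinearMap.ext fun _ => rfl
    refine ⟨L, ?_⟩
    rw [hLc]
    exact (hFat (x, 0) hx).hasStrictFDerivAt' (hderiv0 x hx) (by simp)
  -- injectivity on `B̄(0, 1 + δ₀) × B(0, ε)` from local injectivity and injectivity of the zero section
  haveI : CompactSpace (closedBall (0 : EuclideanSpace ℝ (Fin 2)) (1 + δ₀)) :=
    isCompact_iff_compactSpace.1 (isCompact_closedBall _ _)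
  have hsub₀ : closedBall (0 : EuclideanSpace ℝ (Fin 2)) (1 + δ₀) ⊆ ball 0 R' := closedBall_subset_ball hR'
  obtain ⟨ε, hε, hinjε⟩ := exists_injOn_prod_ball
    (g := fun p : closedBall (0 : EuclideanSpace ℝ (Fin 2)) (1 + δ₀) × EuclideanSpace ℝ (Fin 2) => F ((p.1 : EuclideanSpace ℝ (Fin 2)), p.2))
    (by
      have hFc : ContinuousOn F (ball (0 : EuclideanSpace ℝ (Fin 2)) R' ×ˢ univ) := fun q hq =>
        (hFat q hq.1).continuousAt.continuousWithinAt
      exact hFc.comp_continuous (by fun_prop) fun p => ⟨hsub₀ p.1.2, mem_univ _⟩)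
    (by
      intro a b hab
      simp only [hF0] at hab
      exact Subtype.ext (hinj₀ a.2 b.2 hab))
    (by
      intro a
      obtain ⟨L, hL⟩ := hstrict0 a (hsub₀ a.2)
      set Φ := hL.toOpenPartialHomeomorph F with hΦ
      have hsrc : Φ.source ∈ 𝓝 (((a : EuclideanSpace ℝ (Fin 2)), (0 : EuclideanSpace ℝ (Fin 2))) : EuclideanSpace ℝ (Fin 2) × EuclideanSpace ℝ (Fin 2)) :=
        Φ.open_source.mem_nhds hL.mem_toOpenPartialHomeomorph_source
      have hcont : Continuous fun p : closedBall (0 : EuclideanSpace ℝ (Fin 2)) (1 + δ₀) × EuclideanSpace ℝ (Fin 2) =>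
          (((p.1 : EuclideanSpace ℝ (Fin 2)), p.2) : EuclideanSpace ℝ (Fin 2) × EuclideanSpace ℝ (Fin 2)) := by fun_prop
      refine ⟨_, hcont.continuousAt.preimage_mem_nhds hsrc, fun p hp q hq hpq => ?_⟩
      have h : (((p.1 : EuclideanSpace ℝ (Fin 2)), p.2) : EuclideanSpace ℝ (Fin 2) × EuclideanSpace ℝ (Fin 2)) =
          ((q.1 : EuclideanSpace ℝ (Fin 2)), q.2) :=
        Φ.injOn hp hq (by simpa [hΦ, HasStrictFDerivAt.toOpenPartialHomeomorph_coe] using hpq)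
      obtain ⟨h1, h2⟩ := Prod.mk.inj h
      exact Prod.ext (Subtype.ext h1) h2)
  have hinjF : InjOn F (closedBall (0 : EuclideanSpace ℝ (Fin 2)) (1 + δ₀) ×ˢ ball (0 : EuclideanSpace ℝ (Fin 2)) ε) := by
    rintro ⟨x, v⟩ ⟨hx, hv⟩ ⟨y, w⟩ ⟨hy, hw⟩ h
    have := hinjε (mk_mem_prod (mem_univ (⟨x, hx⟩ : closedBall (0 : EuclideanSpace ℝ (Fin 2)) (1 + δ₀))) hv)
      (mk_mem_prod (mem_univ (⟨y, hy⟩ : closedBall (0 : EuclideanSpace ℝ (Fin 2)) (1 + δ₀))) hw) h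
    simp only [Prod.mk.injEq, Subtype.mk.injEq] at this
    exact Prod.ext this.1 this.2
  -- invertible derivative on `B̄(0, 1 + δ₀) × B̄(0, η₁)` (openness of invertibility, compactness)
  set Ω : Set (EuclideanSpace ℝ (Fin 2) × EuclideanSpace ℝ (Fin 2)) :=
    (ball (0 : EuclideanSpace ℝ (Fin 2)) R' ×ˢ univ) ∩ (fun q => fderiv ℝ F q) ⁻¹'
      range ((↑) : ((EuclideanSpace ℝ (Fin 2) × EuclideanSpace ℝ (Fin 2)) ≃L[ℝ] EuclideanSpace ℝ (Fin 4)) →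
        (EuclideanSpace ℝ (Fin 2) × EuclideanSpace ℝ (Fin 2)) →L[ℝ] EuclideanSpace ℝ (Fin 4)) with hΩ
  have hΩo : IsOpen Ω := by
    have hc : ContinuousOn (fun q => fderiv ℝ F q) (ball (0 : EuclideanSpace ℝ (Fin 2)) R' ×ˢ univ) := by
      have h1 : ContDiffOn ℝ ∞ F (ball (0 : EuclideanSpace ℝ (Fin 2)) R' ×ˢ univ) := fun q hq => (hFat q hq.1).contDiffWithinAt
      exact h1.continuousOn_fderiv_of_isOpen (isOpen_ball.prod isOpen_univ) (by simp)
    exact hc.isOpen_inter_preimage (isOpen_ball.prod isOpen_univ) ContinuousLinearEquiv.isOpen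
  have hK₀ : closedBall (0 : EuclideanSpace ℝ (Fin 2)) (1 + δ₀) ×ˢ ({0} : Set (EuclideanSpace ℝ (Fin 2))) ⊆ Ω := by
    rintro ⟨x, w⟩ ⟨hx, hw⟩
    rw [mem_singleton_iff] at hw
    subst hw
    obtain ⟨L, hL⟩ := hstrict0 x (hsub₀ hx)
    exact ⟨⟨hsub₀ hx, mem_univ _⟩, ⟨L, hL.hasFDerivAt.fderiv.symm⟩⟩
  obtain ⟨η₁, hη₁, hthick⟩ := ((isCompact_closedBall (0 : EuclideanSpace ℝ (Fin 2)) (1 + δ₀)).prod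
    isCompact_singleton).exists_thickening_subset_open hΩo hK₀
  have hΩmem : ∀ q : EuclideanSpace ℝ (Fin 2) × EuclideanSpace ℝ (Fin 2), q.1 ∈ closedBall (0 : EuclideanSpace ℝ (Fin 2)) (1 + δ₀) →
      ‖q.2‖ < η₁ → q ∈ Ω := by
    rintro ⟨x, w⟩ hx hw
    refine hthick (Metric.mem_thickening_iff.2 ⟨(x, 0), ⟨hx, rfl⟩, ?_⟩)
    rw [Prod.dist_eq, dist_self, dist_zero_right]
    exact max_lt_iff.2 ⟨hη₁, hw⟩
  have hstrict : ∀ q : EuclideanSpace ℝ (Fin 2) × EuclideanSpace ℝ (Fin 2), q ∈ Ω →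
      ∃ L : (EuclideanSpace ℝ (Fin 2) × EuclideanSpace ℝ (Fin 2)) ≃L[ℝ] EuclideanSpace ℝ (Fin 4),
        HasStrictFDerivAt F (L : _ →L[ℝ] _) q := by
    rintro q ⟨hq, ⟨L, hL⟩⟩
    refine ⟨L, ?_⟩
    rw [hL]
    exact (hFat q hq.1).hasStrictFDerivAt (by simp)
  -- the final radii
  set η : ℝ := min ε η₁ / 2 with hηdef
  have hηpos : 0 < η := by rw [hηdef]; have := lt_min hε hη₁; linarith
  have hηε : η < ε := by rw [hηdef]; have := min_le_left ε η₁; linarith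
  have hηη₁ : η < η₁ := by rw [hηdef]; have := min_le_right ε η₁; linarith
  set dom : Set (EuclideanSpace ℝ (Fin 2) × EuclideanSpace ℝ (Fin 2)) :=
    ball (0 : EuclideanSpace ℝ (Fin 2)) (1 + δ) ×ˢ ball (0 : EuclideanSpace ℝ (Fin 2)) η with hdom
  have hdomo : IsOpen dom := isOpen_ball.prod isOpen_ball
  have hdomΩ : dom ⊆ Ω := fun q hq =>
    hΩmem q (mem_closedBall_zero_iff.2 (by linarith [mem_ball_zero_iff.1 hq.1])) (lt_trans (mem_ball_zero_iff.1 hq.2) hηη₁)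
  have hdominj : dom ⊆ closedBall (0 : EuclideanSpace ℝ (Fin 2)) (1 + δ₀) ×ˢ ball (0 : EuclideanSpace ℝ (Fin 2)) ε := fun q hq =>
    ⟨mem_closedBall_zero_iff.2 (by linarith [mem_ball_zero_iff.1 hq.1]), mem_ball_zero_iff.2 (lt_trans (mem_ball_zero_iff.1 hq.2) hηε)⟩
  -- openness of the image
  have hopen : IsOpen (F '' dom) := by
    rw [isOpen_iff_mem_nhds]
    rintro _ ⟨q, hq, rfl⟩
    obtain ⟨L, hL⟩ := hstrict q (hdomΩ hq)
    rw [← hL.map_nhds_eq_of_equiv]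
    exact Filter.image_mem_map (hdomo.mem_nhds hq)
  -- the inverse and its smoothness
  set Finv : EuclideanSpace ℝ (Fin 4) → EuclideanSpace ℝ (Fin 2) × EuclideanSpace ℝ (Fin 2) := invFunOn F dom with hFinv
  have hinjdom : InjOn F dom := hinjF.mono hdominj
  have hleft : ∀ q ∈ dom, Finv (F q) = q := fun q hq => hinjdom.leftInvOn_invFunOn hq
  have hsmooth : ContDiffOn ℝ ∞ Finv (F '' dom) := by
    rintro _ ⟨q, hq, rfl⟩
    refine ContDiffAt.contDiffWithinAt ?_
    obtain ⟨L, hL⟩ := hstrict q (hdomΩ hq)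
    have hev : ∀ᶠ p in 𝓝 q, Finv (F p) = p := by
      filter_upwards [hdomo.mem_nhds hq] with p hp
      exact hleft p hp
    have huniq := hL.localInverse_unique hev
    have hcd : ContDiffAt ℝ ∞ F q := hFat q (hdomΩ hq).1.1
    have hloc : ContDiffAt ℝ ∞ (hcd.localInverse hL.hasFDerivAt (by simp)) (F q) :=
      hcd.to_localInverse hL.hasFDerivAt (by simp)
    exact hloc.congr_of_eventuallyEq huniq
  refine ⟨δ, η, F, Finv, hδpos, hηpos, hinj₀.mono (closedBall_subset_closedBall (by linarith)),
    fun x hx => himm' x (ball_subset_ball h2δ.le hx), hF0, hFon, ?_, hopen, hsmooth, hleft⟩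
  exact hinjF.mono (prod_mono (closedBall_subset_closedBall (by linarith)) (closedBall_subset_ball hηε))

end FriendsCarrierVk

open FriendsCarrierVk in
/-- **Helper `helper_friendsCarrier_Vk_discTube`** (registered piece of `helper_friendsCarrier_Vk`: the framed
tube, with smooth inverse, of the slightly enlarged model slice disc).  For a model slice disc `f₁` of a
model knot there are `δ, η > 0`, a map `F : ℝ² × ℝ² → ℝ⁴` with `F(x, 0) = f₁ x`, `C^∞` on
`B(0, 1 + 2δ) × ℝ²`, injective on `B̄(0, 1 + δ) × B̄(0, η)`, with open image of `B(0, 1 + δ) × B(0, η)`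
and a `C^∞` left inverse `Finv` there; moreover `f₁` is injective on `B̄(0, 1 + δ)` and immersive on
`B(0, 1 + 2δ)`. [cite: Hirsch1976, Ch. 4 §5 Thm. 5.1] -/
theorem helper_friendsCarrier_Vk_discTube : ∀ (k : ℕ) (K₁ : (Metric.sphere (0 : EuclideanSpace ℝ (Fin 2)) 1) → EuclideanSpace ℝ (Fin 4)) (f₁ : EuclideanSpace ℝ (Fin 2) → EuclideanSpace ℝ (Fin 4)), Literature.Topology.FourManifolds.MMSW.IsModelSliceDisc k K₁ f₁ → ∃ (δ η : ℝ) (F : EuclideanSpace ℝ (Fin 2) × EuclideanSpace ℝ (Fin 2) → EuclideanSpace ℝ (Fin 4)) (Finv : EuclideanSpace ℝ (Fin 4) → EuclideanSpace ℝ (Fin 2) × EuclideanSpace ℝ (Fin 2)), 0 < δ ∧ 0 < η ∧ Set.InjOn f₁ (Metric.closedBall (0 : EuclideanSpace ℝ (Fin 2)) (1 + δ)) ∧ (∀ x ∈ Metric.ball (0 : EuclideanSpace ℝ (Fin 2)) (1 + 2 * δ), Function.Injective (fderiv ℝ f₁ x)) ∧ (∀ x, F (x, 0) = f₁ x) ∧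 ContDiffOn ℝ ((⊤ : ℕ∞) : WithTop ℕ∞) F (Metric.ball (0 : EuclideanSpace ℝ (Fin 2)) (1 + 2 * δ) ×ˢ Set.univ) ∧ Set.InjOn F (Metric.closedBall (0 : EuclideanSpace ℝ (Fin 2)) (1 + δ) ×ˢ Metric.closedBall (0 : EuclideanSpace ℝ (Fin 2)) η) ∧ IsOpen (F '' (Metric.ball (0 : EuclideanSpace ℝ (Fin 2)) (1 + δ) ×ˢ Metric.ball (0 : EuclideanSpace ℝ (Fin 2)) η)) ∧ ContDiffOn ℝ ((⊤ : ℕ∞) : WithTop ℕ∞) Finv (F '' (Metric.ball (0 : EuclideanSpace ℝ (Fin 2)) (1 + δ) ×ˢ Metric.ball (0 : EuclideanSpace ℝ (Fin 2)) η)) ∧ (∀ q ∈ Metric.ball (0 : EuclideanSpace ℝ (Fin 2)) (1 + δ) ×ˢ Metric.ball (0 : EuclideanSpace ℝ (Fin 2)) η, Finv (F q) = q) := by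
  intro k K₁ f₁ hf
  have hfs : ContDiff ℝ ∞ f₁ := contMDiff_iff_contDiff.1 hf.1
  have himm : ∀ x ∈ closedBall (0 : EuclideanSpace ℝ (Fin 2)) 1, Injective (fderiv ℝ f₁ x) := fun x hx => by
    have h := hf.2.2.1 x hx
    rwa [mfderiv_eq_fderiv] at h
  exact exists_discTube hfs hf.2.1 himm

end Summit.SmoothPoincare4.SmoothPoincare4.Theorems.DcrGap.MkFriends

end
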